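import Mathlib
import Literature.AlgebraicGeometry.Resolution.WeightedInitialTerms
import HarnessLib

/-!
# Weighted initial forms over the residue field

Topic: `Literature/AlgebraicGeometry/Resolution`. For a regular local ring `(R, 𝔪, k)` of
dimension `3` with regular system of parameters `c = (y, u₁, u₂)` and a positive weight `w`, the
graded ring of the weighted order filtration `F^{(w)}_•` is the weighted polynomial ring
`k[Y, U₁, U₂]` (weighted quasi-regularity, `WeightedQuasiRegularGeneral`); the **initial form**
of `f ∈ F_n` in degree `n` is the class of `f` in `F_n/F_{n+1} ≅ k[Y, U]_n`
(Cossart–Jannsen–Saito, LNM 2270, Definition 8.2 (2)–(4): `in_v(g), in_{E_L}(g)`;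
Cossart–Piltant 2008, (13): `in_v(f)`, `in_v(E) = ⟨in_v(f) : f ∈ J⟩` and the notion of a
SOLVABLE vertex: `in_v(E) = k · (Y + λ U^v)^μ`). Expansion-free definition: `IsInForm c w n f P`
— `P ∈ k[X]` is the reduction of a `w`-homogeneous `F ∈ R[X]` of weight `n` with
`f ≡ F(c) mod F_{n+1}`; it exists (unit representatives) and is unique (weighted
quasi-regularity), and `inForm c w n f` is the resulting polynomial. PROVED, no facts:

* `IsInForm.exists`, `IsInForm.unique`, `isInForm_inForm`, `inForm_eq_zero_iff`
  (`in_n(f) = 0 ⟺ f ∈ F_{n+1}`), `mem_support_inForm_iff` (support = initial unit terms),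
  `IsInForm.mul`, `IsInForm.add`, `IsInForm.smul` (graded ring structure);
* `IsSolvableAt c J w n v lam` — every `in_n(f)`, `f ∈ J`, is a multiple of `(Y + λ U^v)^μ`
  (CoP1 p. 11 / CJS Def. 8.11), and `not_isInitialTerm_of_isSolvableAt`-type consequences are
  left to the dissolution file.

## Sources

* V. Cossart, U. Jannsen, S. Saito, LNM 2270 (2020), Def. 8.2, Lemma 8.3, Def. 8.11.
  [CossartJannsenSaito2020]
* V. Cossart, O. Piltant, J. Algebra 320 (2008), §4, (13) and p. 11 (solvable vertices).
  [CossartPiltant2008]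
* H. Hironaka, J. Math. Kyoto Univ. 7 (1967), §3. [Hironaka1967]
-/

noncomputable section

open IsLocalRing MvPolynomial

namespace Literature.AlgebraicGeometry.Resolution

universe u

variable {R : Type u} [CommRing R]

/-- **`P` is the `w`-initial form of `f` in degree `n`**: `P` is the reduction modulo `𝔪` of a
`w`-homogeneous `F ∈ R[Y, U₁, U₂]` of weight `n` with `f ≡ F(c) mod F^{(w)}_{n+1}`.
[cite: CossartJannsenSaito2020, Def. 8.2 (2)] [cite: CossartPiltant2008, §4 (13)] -/
def IsInForm [IsLocalRing R] (c : Fin 3 → R) (w : Fin 3 → ℕ) (n : ℕ) (f : R)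
    (P : MvPolynomial (Fin 3) (ResidueField R)) : Prop :=
  ∃ F : MvPolynomial (Fin 3) R, F.IsWeightedHomogeneous w n ∧
    MvPolynomial.map (residue R) F = P ∧ f - eval c F ∈ weightedIdealW c w (n + 1)

/-- **The `w`-initial form of `f` in degree `n`** (a chosen witness; meaningful when `f ∈ F_n`).
[cite: CossartJannsenSaito2020, Def. 8.2 (2)] -/
def inForm [IsLocalRing R] (c : Fin 3 → R) (w : Fin 3 → ℕ) (n : ℕ) (f : R) :
    MvPolynomial (Fin 3) (ResidueField R) :=
  Classical.epsilon (fun P => IsInForm c w n f P)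

/-- An element with an initial form in degree `n` lies in `F_n`. [folklore] -/
theorem IsInForm.mem [IsLocalRing R] {c : Fin 3 → R} {w : Fin 3 → ℕ} {n : ℕ} {f : R}
    {P : MvPolynomial (Fin 3) (ResidueField R)} (h : IsInForm c w n f P) :
    f ∈ weightedIdealW c w n := by
  obtain ⟨F, hF, -, hrem⟩ := h
  have h1 : eval c F ∈ weightedIdealW c w n :=
    eval_mem_weightedIdealW_of_forall_le c w fun m hm => (hF (mem_support_iff.mp hm)).ge
  have h2 := weightedIdealW_antitone c w (Nat.le_succ n) hrem
  have : f = f - eval c F + eval c F := by ring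
  rw [this]; exact Ideal.add_mem _ h2 h1

/-- The reduction of a polynomial with coefficients in `𝔪` is zero, and conversely. [folklore] -/
theorem map_residue_eq_zero_iff [IsLocalRing R] (F : MvPolynomial (Fin 3) R) :
    MvPolynomial.map (residue R) F = 0 ↔ ∀ m, F.coeff m ∈ maximalIdeal R := by
  rw [MvPolynomial.ext_iff]
  refine forall_congr' fun m => ?_
  rw [coeff_map, coeff_zero, residue_eq_zero_iff]

/-- A `w`-homogeneous polynomial with coefficients in `𝔪` evaluates into `F_{n+1}` (positive
weights, `(c) = 𝔪`). [folklore] -/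
theorem eval_mem_succ_of_coeff_mem [IsLocalRing R] (c : Fin 3 → R)
    (hgen : Ideal.span (Set.range c) = maximalIdeal R)
    {w : Fin 3 → ℕ} (hw : ∀ i, 0 < w i) {n : ℕ} {F : MvPolynomial (Fin 3) R}
    (hF : F.IsWeightedHomogeneous w n) (hc : ∀ m, F.coeff m ∈ maximalIdeal R) :
    eval c F ∈ weightedIdealW c w (n + 1) := by
  rw [F.as_sum, map_sum]
  refine Ideal.sum_mem _ fun m hm => ?_
  rw [eval_monomial_eq_monom3]
  have hmono : monom3 c m ∈ weightedIdealW c w n :=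
    monomial_mem_weightedIdealW c w (hF (mem_support_iff.mp hm)).ge
  exact maximalIdeal_mul_weightedIdealW_le c w hw hgen n (Ideal.mul_mem_mul (hc m) hmono)

/-! ### Graded ring structure -/

/-- **Products**: `in_{n+m}(f g) = in_n(f) · in_m(g)`. [cite: CossartJannsenSaito2020, Lemma 8.3] -/
theorem IsInForm.mul [IsLocalRing R] (c : Fin 3 → R) {w : Fin 3 → ℕ} {n m : ℕ} {f g : R}
    {P Q : MvPolynomial (Fin 3) (ResidueField R)} (hP : IsInForm c w n f P)
    (hQ : IsInForm c w m g Q) : IsInForm c w (n + m) (f * g) (P * Q) := by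
  have hfn := hP.mem
  have hgm := hQ.mem
  obtain ⟨F, hF, rfl, hFrem⟩ := hP
  obtain ⟨G, hG, rfl, hGrem⟩ := hQ
  refine ⟨F * G, hF.mul hG, by rw [map_mul], ?_⟩
  have hFc : eval c F ∈ weightedIdealW c w n :=
    eval_mem_weightedIdealW_of_forall_le c w fun d hd => (hF (mem_support_iff.mp hd)).ge
  have : f * g - eval c (F * G) = f * (g - eval c G) + (f - eval c F) * eval c G := by
    rw [map_mul]; ring
  rw [this]
  refine Ideal.add_mem _ ?_ ?_
  · have := weightedIdealW_mul_le c w n (m + 1) (Ideal.mul_mem_mul hfn hGrem)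
    rwa [← add_assoc] at this
  · have hGc : eval c G ∈ weightedIdealW c w m :=
      eval_mem_weightedIdealW_of_forall_le c w fun d hd => (hG (mem_support_iff.mp hd)).ge
    have := weightedIdealW_mul_le c w (n + 1) m (Ideal.mul_mem_mul hFrem hGc)
    rwa [add_right_comm] at this

/-- **Sums**: `in_n(f + g) = in_n(f) + in_n(g)` (same degree). [cite: CossartJannsenSaito2020, Lemma 8.3] -/
theorem IsInForm.add [IsLocalRing R] (c : Fin 3 → R) {w : Fin 3 → ℕ} {n : ℕ} {f g : R}
    {P Q : MvPolynomial (Fin 3) (ResidueField R)} (hP : IsInForm c w n f P)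
    (hQ : IsInForm c w n g Q) : IsInForm c w n (f + g) (P + Q) := by
  obtain ⟨F, hF, rfl, hFrem⟩ := hP
  obtain ⟨G, hG, rfl, hGrem⟩ := hQ
  refine ⟨F + G, hF.add hG, by rw [map_add], ?_⟩
  have : f + g - eval c (F + G) = (f - eval c F) + (g - eval c G) := by rw [map_add]; ring
  rw [this]; exact Ideal.add_mem _ hFrem hGrem

/-- **Scalars**: `in_n(a f) = ā · in_n(f)` for `a ∈ R`. [cite: CossartJannsenSaito2020, Lemma 8.3] -/
theorem IsInForm.smul [IsLocalRing R] (c : Fin 3 → R) {w : Fin 3 → ℕ} {n : ℕ} {f : R} {P : MvPolynomial (Fin 3) (ResidueField R)}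
    (hP : IsInForm c w n f P) (a : R) : IsInForm c w n (a * f) (C (residue R a) * P) := by
  obtain ⟨F, hF, rfl, hFrem⟩ := hP
  refine ⟨C a * F, ?_, by rw [map_mul, map_C], ?_⟩
  · intro d hd
    rw [coeff_C_mul] at hd
    exact hF (right_ne_zero_of_mul hd)
  · have : a * f - eval c (C a * F) = a * (f - eval c F) := by rw [map_mul, eval_C]; ring
    rw [this]; exact Ideal.mul_mem_left _ _ hFrem

/-- **Zero in lower degree**: if `f ∈ F_{n+1}` then `0` is an initial form of `f` in degree `n`.
[folklore] -/
theorem isInForm_zero_of_mem_succ [IsLocalRing R] (c : Fin 3 → R) {w : Fin 3 → ℕ} {n : ℕ} {f : R}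
    (hf : f ∈ weightedIdealW c w (n + 1)) : IsInForm c w n f 0 :=
  ⟨0, isWeightedHomogeneous_zero _ _ _, by simp, by simpa using hf⟩

section Regular

variable [IsRegularLocalRing R] (c : Fin 3 → R)
  (hgen : Ideal.span {c 0, c 1, c 2} = maximalIdeal R) (hdim : ringKrullDim R = 3)

include hgen hdim in
/-- **Existence of initial forms**: every `f ∈ F_n` has a `w`-initial form in degree `n`
(the reduction of the weight-`n` component of a unit representative). [cite: CossartJannsenSaito2020, Def. 8.2] -/
theorem IsInForm.exists {w : Fin 3 → ℕ} (hw : ∀ i, 0 < w i) {n : ℕ} {f : R}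
    (hf : f ∈ weightedIdealW c w n) : ∃ P, IsInForm c w n f P := by
  have hgenr := span_range_eq_of_span_triple c hgen
  obtain ⟨F, hFu, -, hFrem⟩ := exists_unitRep_weighted c hgenr hw f (n + 1)
  have hmin : ∀ m ∈ F.support, n ≤ Finsupp.weight w m :=
    (mem_weightedIdealW_iff_of_unitRep c hgen hdim hw hFu hFrem (Nat.le_succ n)).mp hf
  refine ⟨MvPolynomial.map (residue R) (weightedHomogeneousComponent w n F),
    weightedHomogeneousComponent w n F, weightedHomogeneousComponent_isWeightedHomogeneous n F,
    rfl, ?_⟩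
  have h3 := eval_sub_component_mem c w hmin
  have : f - eval c (weightedHomogeneousComponent w n F) =
      (f - eval c F) + eval c (F - weightedHomogeneousComponent w n F) := by rw [map_sub]; ring
  rw [this]; exact Ideal.add_mem _ hFrem h3

include hgen hdim in
/-- **Uniqueness of initial forms** (weighted quasi-regularity). [cite: CossartJannsenSaito2020, Lemma 8.3 (1)] -/
theorem IsInForm.unique {w : Fin 3 → ℕ} (hw : ∀ i, 0 < w i) {n : ℕ} {f : R}
    {P Q : MvPolynomial (Fin 3) (ResidueField R)} (hP : IsInForm c w n f P)
    (hQ : IsInForm c w n f Q) : P = Q := by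
  obtain ⟨F, hF, rfl, hFrem⟩ := hP
  obtain ⟨G, hG, rfl, hGrem⟩ := hQ
  rw [← sub_eq_zero, ← map_sub, map_residue_eq_zero_iff]
  have hdiff : eval c (F - G) ∈ weightedIdealW c w (n + 1) := by
    have : eval c (F - G) = (f - eval c G) - (f - eval c F) := by rw [map_sub]; ring
    rw [this]; exact Ideal.sub_mem _ hGrem hFrem
  have hhom := isWeightedHomogeneous_sub hF hG
  have hsupp : ∀ m ∈ (F - G).support, Finsupp.weight w m = n := fun m hm =>
    hhom (mem_support_iff.mp hm)
  exact coeff_mem_maximalIdeal_of_weval_mem_general c hgen hdim w hw hsupp hdiff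

include hgen hdim in
/-- `inForm c w n f` is the initial form of `f ∈ F_n`. [cite: CossartJannsenSaito2020, Def. 8.2] -/
theorem isInForm_inForm {w : Fin 3 → ℕ} (hw : ∀ i, 0 < w i) {n : ℕ} {f : R}
    (hf : f ∈ weightedIdealW c w n) : IsInForm c w n f (inForm c w n f) :=
  Classical.epsilon_spec (IsInForm.exists c hgen hdim hw hf)

include hgen hdim in
/-- Any initial form witness equals `inForm`. [folklore] -/
theorem IsInForm.eq_inForm {w : Fin 3 → ℕ} (hw : ∀ i, 0 < w i) {n : ℕ} {f : R}
    {P : MvPolynomial (Fin 3) (ResidueField R)} (hP : IsInForm c w n f P) : P = inForm c w n f :=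
  IsInForm.unique c hgen hdim hw hP (isInForm_inForm c hgen hdim hw hP.mem)

include hgen hdim in
/-- **`in_n(f) = 0 ⟺ f ∈ F_{n+1}`** (for `f ∈ F_n`). [cite: CossartJannsenSaito2020, Lemma 8.3] -/
theorem inForm_eq_zero_iff {w : Fin 3 → ℕ} (hw : ∀ i, 0 < w i) {n : ℕ} {f : R}
    (hf : f ∈ weightedIdealW c w n) : inForm c w n f = 0 ↔ f ∈ weightedIdealW c w (n + 1) := by
  have hgenr := span_range_eq_of_span_triple c hgen
  obtain ⟨F, hF, hFP, hFrem⟩ := isInForm_inForm c hgen hdim hw hf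
  constructor
  · intro h0
    rw [h0, map_residue_eq_zero_iff] at hFP
    have h1 := eval_mem_succ_of_coeff_mem c hgenr hw hF hFP
    have : f = (f - eval c F) + eval c F := by ring
    rw [this]; exact Ideal.add_mem _ hFrem h1
  · intro hf1
    have h0 : IsInForm c w n f 0 := ⟨0, isWeightedHomogeneous_zero _ _ _, by simp, by simpa using hf1⟩
    exact (h0.eq_inForm c hgen hdim hw).symm

include hgen hdim in
/-- **The support of the initial form is the set of initial unit terms** of weight `n`.
[cite: CossartJannsenSaito2020, Def. 8.2 (2), Def. 8.5 (4)] -/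
theorem mem_support_inForm_iff {w : Fin 3 → ℕ} (hw : ∀ i, 0 < w i) {n : ℕ} {f : R}
    (hf : f ∈ weightedIdealW c w n) {e : Fin 3 →₀ ℕ} (he : Finsupp.weight w e = n) :
    e ∈ (inForm c w n f).support ↔ IsInitialTerm c w f e := by
  obtain ⟨F, hF, hFP, hFrem⟩ := isInForm_inForm c hgen hdim hw hf
  rw [← hFP, mem_support_iff, coeff_map, ne_eq, residue_eq_zero_iff]
  constructor
  · intro hu
    have hunit : IsUnit (F.coeff e) := by
      by_contra h; exact hu ((mem_maximalIdeal _).mpr h)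
    refine ⟨F, by rwa [he], hunit, by rwa [he]⟩
  · rintro ⟨G, hG, hGu, hGrem⟩ hmem
    -- compare `F` and `G`: `(G - F)(c) ∈ F_{n+1}`, so `coeff_e (G - F) ∈ 𝔪`, so `coeff_e G ∈ 𝔪`
    rw [he] at hG hGrem
    have hdiff : eval c (G - F) ∈ weightedIdealW c w (n + 1) := by
      have : eval c (G - F) = (f - eval c F) - (f - eval c G) := by rw [map_sub]; ring
      rw [this]; exact Ideal.sub_mem _ hFrem hGrem
    have hhom := isWeightedHomogeneous_sub hG hF
    have hsupp : ∀ m ∈ (G - F).support, Finsupp.weight w m = n := fun m hm =>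
      hhom (mem_support_iff.mp hm)
    have hce : (G - F).coeff e ∈ maximalIdeal R :=
      coeff_mem_maximalIdeal_of_weval_mem_general c hgen hdim w hw hsupp hdiff e
    rw [coeff_sub] at hce
    have : G.coeff e ∈ maximalIdeal R := by
      have := Ideal.add_mem _ hce hmem
      rwa [sub_add_cancel] at this
    exact (mem_maximalIdeal _).mp this hGu

include hgen hdim in
/-- `inForm` of a product. [cite: CossartJannsenSaito2020, Lemma 8.3] -/
theorem inForm_mul {w : Fin 3 → ℕ} (hw : ∀ i, 0 < w i) {n m : ℕ} {f g : R}
    (hf : f ∈ weightedIdealW c w n) (hg : g ∈ weightedIdealW c w m) :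
    inForm c w (n + m) (f * g) = inForm c w n f * inForm c w m g :=
  (((isInForm_inForm c hgen hdim hw hf).mul c (isInForm_inForm c hgen hdim hw hg)).eq_inForm
    c hgen hdim hw).symm

include hgen hdim in
/-- `inForm` of a scalar multiple. [cite: CossartJannsenSaito2020, Lemma 8.3] -/
theorem inForm_smul {w : Fin 3 → ℕ} (hw : ∀ i, 0 < w i) {n : ℕ} {f : R}
    (hf : f ∈ weightedIdealW c w n) (a : R) :
    inForm c w n (a * f) = C (residue R a) * inForm c w n f :=
  (((isInForm_inForm c hgen hdim hw hf).smul c a).eq_inForm c hgen hdim hw).symm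

include hgen hdim in
/-- The initial form is `w`-homogeneous of weight `n`. [folklore] -/
theorem isWeightedHomogeneous_inForm {w : Fin 3 → ℕ} (hw : ∀ i, 0 < w i) {n : ℕ} {f : R}
    (hf : f ∈ weightedIdealW c w n) : (inForm c w n f).IsWeightedHomogeneous w n := by
  obtain ⟨F, hF, hFP, -⟩ := isInForm_inForm c hgen hdim hw hf
  rw [← hFP]
  intro d hd
  rw [coeff_map] at hd
  exact hF (fun h => hd (by rw [h, map_zero]))

/-! ### Solvable vertices (CoP1 p. 11; CJS Definition 8.11) -/

/-- **The initial forms of `J` in degree `n` are all multiples of `(Y + λ U^v)^μ`**: the vertex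
`v` cut out by the weight `w` at level `n` is SOLVABLE by `λ` (Cossart–Piltant: "`in_v(E) =
k(x)·(Y + λ_v U₁^{v₁} U₂^{v₂})^μ`"; CJS Def. 8.11 (2), case `r = 1`, `F(Y) = Y^μ`). Here
`v : Fin 3 →₀ ℕ` is the exponent `(0, v₁, v₂)` of the shift monomial, required to have the weight
of `Y`. [cite: CossartPiltant2008, §4 p. 11] [cite: CossartJannsenSaito2020, Def. 8.11] -/
def IsSolvableAt (c : Fin 3 → R) (J : Ideal R) (w : Fin 3 → ℕ) (n μ : ℕ)
    (v : Fin 3 →₀ ℕ) (lam : ResidueField R) : Prop :=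
  v 0 = 0 ∧ Finsupp.weight w v = w 0 ∧
    ∀ f ∈ J, f ∈ weightedIdealW c w n →
      ∃ a : ResidueField R, inForm c w n f = C a * (X 0 + C lam * monomial v 1) ^ μ

end Regular

/-- The shifted variable `(Y + λ U^v)^μ` is `w`-homogeneous of weight `μ w₀` when `⟨w, v⟩ = w₀`.
[folklore] -/
theorem isWeightedHomogeneous_shift_pow {k : Type*} [CommSemiring k] {w : Fin 3 → ℕ}
    {v : Fin 3 →₀ ℕ} (hv : Finsupp.weight w v = w 0) (lam : k) (μ : ℕ) :
    ((X 0 + C lam * monomial v 1) ^ μ : MvPolynomial (Fin 3) k).IsWeightedHomogeneous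
      w (μ * w 0) := by
  have h1 : (X 0 + C lam * monomial v 1 : MvPolynomial (Fin 3) k).IsWeightedHomogeneous w (w 0) := by
    refine (isWeightedHomogeneous_X _ _ _).add ?_
    rw [C_mul_monomial, mul_one]
    exact isWeightedHomogeneous_monomial _ _ _ hv
  simpa using h1.pow μ

end Literature.AlgebraicGeometry.Resolution
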